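import Summits.ResolutionOfSingularities.ResolutionOfSingularities.Theorems.FrobeniusClosingPatchingRelPerfectCrossingLinesPersistence
import Summits.ResolutionOfSingularities.ResolutionOfSingularities.Theorems.FrobeniusClosingPatchingRelPerfectTwoQuadricMemberTower
import HarnessLib

/-!
# Crux `PatchingRelPerfect` (stmt-ResolutionOfSingularities-16161), chain W5.2 — the CROSSING-LINES
# member `I = (x₀x₁ + x₂x₃, x₃²) + 𝔪⁴`, part 2: the SURFACE STEP and the conic tower behind it
# (ring level)

[OURS · L1 W5.2 · kernel certificate, res-L1-w52-plan-1 NAMING 2026-08-27T17:00:47Z (O2′)]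
Level 2 of the hand tower of the crossing-lines member (chart of `x₂` of `Bl_𝔪`, then chart of
`a = x₀/x₂` of the blowing up of the line `L₀`).  Data: a regular ring `B` and `w, g, u, b ∈ B`
(`g` the exceptional parameter of `L₀`, `w` the strict transform of the host quadric, `V(w, g)`
the SURFACE `S₁ = H′ ∩ F₁`, `V(w, u, b)` the strict transform `L₁′` of the second line, which
meets `S₁` in one point and is transversal to `F₁ = V(g)`).  The residual factors are

  `K₁ = (w) + (g b²) + (g u²)` (member), `A₂ = (w) + (g b) + (g u)` (avatar of `L₁″`),
  `B₂ = (w², w g) + g² · (b², u b, u²)` (avatar of `S₂`), and the centre `N = (w, g)`.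

THIS FILE proves, for `(w, g)` and `(w, u, b)` weakly regular with `B/(w, g)` and `B/(w, u, b)`
regular rings:

* `CrossingLines.conicHyp_gChart` — PERSISTENCE to the `g`-chart `R₃` of `Bl_{(w,g)}`:
  `(u, b, w″)` (`w″ = w/g`) is quasi-regular on `R₃` with `R₃/(u, b, w″)` regular — through
  `R₃/(w″) ≅ B/(w)` (`exists_quotEquiv_single`, part 1: the strict transform of the host is the
  host, `g` being a non-zero-divisor modulo `w`);
* `CrossingLines.surfaceStep_isRegular` — **every blowing up of `Spec B` along
  `(K₁ · A₂ · B₂) · N` is a regular scheme**: `Bl_N` (regular centre), on its `w`-chart the three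
  residual factors are Cartier, on its `g`-chart they are `h⁴ · (K · J) · P` — EXACTLY the conic
  tower of the two-quadric member (`TwoQuadric.conicTower_isRegular`, p543390) for the regular
  centre `P = (u, b, w″) = L₁″` with `K = (w″) + (b²) + (u²)`, `J = (w″) + (b², u b, u²)`.

Any regular ring, no dimension / characteristic hypothesis; fact-free; nothing here is a
statement of the manuscript under review (AI-written; AI review weaker than expert review).

## References

* Q. Liu, *Algebraic Geometry and Arithmetic Curves*, OUP 2002, Thm. 8.1.19 (a). [Liu2002]
* The Stacks Project, Tags 080A, 080B, 0804, 0BIQ. [StacksProject]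
* U. Görtz, T. Wedhorn, *Algebraic Geometry I* (2nd ed., 2020), Prop. 13.96 (2). [GortzWedhorn2020]
* H. Matsumura, *Commutative Ring Theory*, CUP 1986, Thm. 16.2 (i). [Matsumura1987]
-/

-- `Summit.<Summit>.<Sub>.Theorems` with `Sub = Summit` (single-conjunct summit, D-0017)
set_option linter.dupNamespace false

noncomputable section

open CategoryTheory CategoryTheory.Limits AlgebraicGeometry Literature.AlgebraicGeometry.Resolution
open scoped Pointwise nonZeroDivisors

namespace Summit.ResolutionOfSingularities.ResolutionOfSingularities.Theorems

universe u

namespace CrossingLines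

open CuspMember TwoQuadric

/-! ## Ideal algebra of the two charts of `Bl_N`, `N = (w, g)` (any commutative ring) -/

section Algebra

variable {A : Type u} [CommRing A]

/-- `X ⊔ (y) = X ⊔ (z)` when `y - z ∈ X`. [folklore] -/
theorem sup_span_congr_of_sub_mem (X : Ideal A) {y z : A} (h : y - z ∈ X) :
    X ⊔ Ideal.span {y} = X ⊔ Ideal.span {z} := by
  apply le_antisymm
  · refine sup_le le_sup_left ((Ideal.span_singleton_le_iff_mem _).mpr ?_)
    have e : y = (y - z) + z := by ring
    rw [e]
    exact Ideal.add_mem _ (Ideal.mem_sup_left h) (Ideal.mem_sup_right (Ideal.mem_span_singleton_self z))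
  · refine sup_le le_sup_left ((Ideal.span_singleton_le_iff_mem _).mpr ?_)
    have e : z = y - (y - z) := by ring
    rw [e]
    exact Ideal.sub_mem _ (Ideal.mem_sup_right (Ideal.mem_span_singleton_self y)) (Ideal.mem_sup_left h)

/-- **`g`-chart** (`w = h w″`, `g = h`): `K₁ = (h w″, h b², h u²) = h · ((w″) + (b²) + (u²))`.
[folklore] -/
theorem gChart_K₁ (h w b u : A) :
    Ideal.span {h * w} ⊔ Ideal.span {h * b ^ 2} ⊔ Ideal.span {h * u ^ 2} =
      Ideal.span {h} * (Ideal.span {w} ⊔ Ideal.span {b ^ 2} ⊔ Ideal.span {u ^ 2}) := by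
  rw [Ideal.mul_sup, Ideal.mul_sup, Ideal.span_singleton_mul_span_singleton,
    Ideal.span_singleton_mul_span_singleton, Ideal.span_singleton_mul_span_singleton]

/-- **`g`-chart**: `A₂ = (h w″, h b, h u) = h · ((u) + (b) + (w″))` (the conic centre).
[folklore] -/
theorem gChart_A₂ (h w b u : A) :
    Ideal.span {h * w} ⊔ Ideal.span {h * b} ⊔ Ideal.span {h * u} =
      Ideal.span {h} * (Ideal.span {u} ⊔ Ideal.span {b} ⊔ Ideal.span {w}) := by
  rw [Ideal.mul_sup, Ideal.mul_sup, Ideal.span_singleton_mul_span_singleton,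
    Ideal.span_singleton_mul_span_singleton, Ideal.span_singleton_mul_span_singleton]
  ac_rfl

/-- **`g`-chart**: `B₂ = ((h w″)², h w″ h, h² b², h² u b, h² u²) = h² · ((w″) + (b²) + (u b) + (u²))`
(the summand `w″²` is absorbed by `w″`). [folklore] -/
theorem gChart_B₂ (h w b u : A) :
    Ideal.span {(h * w) ^ 2} ⊔ Ideal.span {h * w * h} ⊔ Ideal.span {h ^ 2 * b ^ 2} ⊔
      Ideal.span {h ^ 2 * (u * b)} ⊔ Ideal.span {h ^ 2 * u ^ 2} =
      Ideal.span {h ^ 2} * (Ideal.span {w} ⊔ Ideal.span {b ^ 2} ⊔ Ideal.span {u * b} ⊔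
        Ideal.span {u ^ 2}) := by
  have e1 : Ideal.span {(h * w) ^ 2} ⊔ Ideal.span {h * w * h} = Ideal.span {h ^ 2 * w} := by
    rw [show h * w * h = h ^ 2 * w by ring]
    exact sup_span_eq ⟨w, by ring⟩
  rw [e1, Ideal.mul_sup, Ideal.mul_sup, Ideal.mul_sup, Ideal.span_singleton_mul_span_singleton,
    Ideal.span_singleton_mul_span_singleton, Ideal.span_singleton_mul_span_singleton,
    Ideal.span_singleton_mul_span_singleton]

/-- Collecting on the `g`-chart: `(h K)(h P)(h² J) = h⁴ · ((K J) P)`. [folklore] -/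
theorem collect_gChart (h : A) (K P J : Ideal A) :
    Ideal.span {h} * K * (Ideal.span {h} * P) * (Ideal.span {h ^ 2} * J) =
      Ideal.span {h ^ 4} * ((K * J) * P) := by
  rw [← Ideal.span_singleton_pow, ← Ideal.span_singleton_pow]
  ring

/-- **`w`-chart** (`w = h`, `g = h g′`): `K₁` and `A₂` are `(h)`. [folklore] -/
theorem wChart_three (h g c d : A) :
    Ideal.span {h} ⊔ Ideal.span {h * g * c} ⊔ Ideal.span {h * g * d} = Ideal.span {h} :=
  span_sup_sup_eq ⟨g * c, by ring⟩ ⟨g * d, by ring⟩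

/-- **`w`-chart**: `B₂ = (h²)`. [folklore] -/
theorem wChart_B₂ (h g b u : A) :
    Ideal.span {h ^ 2} ⊔ Ideal.span {h * (h * g)} ⊔ Ideal.span {(h * g) ^ 2 * b ^ 2} ⊔
      Ideal.span {(h * g) ^ 2 * (u * b)} ⊔ Ideal.span {(h * g) ^ 2 * u ^ 2} = Ideal.span {h ^ 2} := by
  have a1 : Ideal.span {h ^ 2} ⊔ Ideal.span {h * (h * g)} = Ideal.span {h ^ 2} :=
    span_sup_eq ⟨g, by ring⟩
  rw [a1, span_sup_sup_eq ⟨g ^ 2 * b ^ 2, by ring⟩ ⟨g ^ 2 * (u * b), by ring⟩]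
  exact span_sup_eq ⟨g ^ 2 * u ^ 2, by ring⟩

/-! ### Images of the three residual factors under a ring map -/

variable {C : Type u} [CommRing C] (φ : A →+* C) (w g u b : A)

/-- Image of `K₁ = (w) + (g b²) + (g u²)`. [folklore] -/
theorem map_K₁ : (Ideal.span {w} ⊔ Ideal.span {g * b ^ 2} ⊔ Ideal.span {g * u ^ 2}).map φ =
    Ideal.span {φ w} ⊔ Ideal.span {φ g * φ b ^ 2} ⊔ Ideal.span {φ g * φ u ^ 2} := by
  simp only [Ideal.map_sup, map_span_singleton, map_mul, map_pow]

/-- Image of `A₂ = (w) + (g b) + (g u)`. [folklore] -/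
theorem map_A₂ : (Ideal.span {w} ⊔ Ideal.span {g * b} ⊔ Ideal.span {g * u}).map φ =
    Ideal.span {φ w} ⊔ Ideal.span {φ g * φ b} ⊔ Ideal.span {φ g * φ u} := by
  simp only [Ideal.map_sup, map_span_singleton, map_mul]

/-- Image of `B₂ = (w², w g) + g² (b², u b, u²)`. [folklore] -/
theorem map_B₂ : (Ideal.span {w ^ 2} ⊔ Ideal.span {w * g} ⊔ Ideal.span {g ^ 2 * b ^ 2} ⊔
    Ideal.span {g ^ 2 * (u * b)} ⊔ Ideal.span {g ^ 2 * u ^ 2}).map φ =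
    Ideal.span {φ w ^ 2} ⊔ Ideal.span {φ w * φ g} ⊔ Ideal.span {φ g ^ 2 * φ b ^ 2} ⊔
      Ideal.span {φ g ^ 2 * (φ u * φ b)} ⊔ Ideal.span {φ g ^ 2 * φ u ^ 2} := by
  simp only [Ideal.map_sup, map_span_singleton, map_mul, map_pow]

end Algebra

/-! ## Persistence of the hypotheses to the `g`-chart of `Bl_{(w, g)}` -/

section Persistence

variable {B : Type u} [CommRing B] (w g u b : B)

/-- The centre `N = (w, g)` as a family. -/
local notation3 "yy" => (![w, g] : Fin 2 → B)
/-- The complement `{g}` of `J = {w}`, indexed by `Fin 1`. -/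
local notation3 "emb" => (fun _ : Fin 1 => (1 : Fin 2))
/-- `J = {w}` as a sub-family of the indices `≠ 1`. -/
local notation3 "jJ" => (fun _ : Fin 1 => (⟨0, of_decide_eq_true rfl⟩ : {j : Fin 2 // j ≠ emb 0}))

/-- The base ideal of `jJ` is `(w)`. [folklore] -/
theorem Qw_eq : Ideal.span (Set.range fun k : Fin 1 => yy (jJ k).1) = Ideal.span {w} := by
  have : (fun k : Fin 1 => yy (jJ k).1) = fun _ => w := by funext k; rfl
  rw [this, Set.range_const]

/-- The exceptional ideal of `jJ` is `(w″)`, `w″ = w/g`. [folklore] -/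
theorem Ew_eq : Ideal.span (Set.range fun k : Fin 1 => chartGen yy (emb 0) (jJ k).1) =
    Ideal.span {chartGen yy 1 0} := by
  have : (fun k : Fin 1 => chartGen yy (emb 0) (jJ k).1) = fun _ => chartGen yy 1 0 := by
    funext k; rfl
  rw [this, Set.range_const]

/-- `jJ` and `emb` cover all indices. [folklore] -/
theorem cov_w : ∀ j : Fin 2, (∃ k, emb k = j) ∨ ∃ k, (jJ k).1 = j := by decide

/-- Re-indexing `(w″, u, b) ↦ (u, b, w″)` by two transpositions. [folklore] -/
theorem vec3_rotate {C : Type u} (p q r : C) :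
    ((![p, q, r] : Fin 3 → C) ∘ (Equiv.swap (0 : Fin 3) 1)) ∘ (Equiv.swap (1 : Fin 3) 2) = ![q, r, p] := by
  funext k
  fin_cases k <;> rfl

/-- **PERSISTENCE to the `g`-chart.** For `(w, g)` and `(w, u, b)` weakly regular on `B` with
`B/(w, u, b)` regular, on the `g`-chart `R₃` of `Bl_{(w, g)} Spec B` the family `(u, b, w″)`
(`w″ = w/g` the strict transform of the host) is quasi-regular and `R₃/(u, b, w″)` is a regular
ring: `R₃/(w″) ≅ B/(w)` (part 1, `exists_quotEquiv_single`), under which `u, b ↦ ū, b̄`.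
[cite: GortzWedhorn2020, Prop. 13.96 (2)] [cite: Matsumura1987, Thm. 16.2 (i)] -/
theorem conicHyp_gChart (hwg : RingTheory.Sequence.IsWeaklyRegular B [w, g])
    (hwub : RingTheory.Sequence.IsWeaklyRegular B [w, u, b])
    (hPreg : IsRegularRing (B ⧸ (Ideal.span {w} ⊔ Ideal.span {u} ⊔ Ideal.span {b}))) :
    IsQuasiRegular (![chartBase yy 1 u, chartBase yy 1 b, chartGen yy 1 0] : Fin 3 → chartRing yy 1) ∧
    IsRegularRing (chartRing yy 1 ⧸ (Ideal.span {chartBase yy 1 u} ⊔ Ideal.span {chartBase yy 1 b} ⊔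
      Ideal.span {chartGen yy 1 0})) := by
  have hx : IsQuasiRegular yy := isQuasiRegular_two hwg
  have hjJ : Function.Injective jJ := fun i j _ => Subsingleton.elim i j
  have hw0 : w ∈ B⁰ := nzd_of_isWeaklyRegular_two hwg
  -- `ḡ` is a non-zero-divisor of `B/(w)`
  have hnz : Ideal.Quotient.mk (Ideal.span (Set.range fun k : Fin 1 => yy (jJ k).1)) (yy (emb 0)) ∈
      (B ⧸ Ideal.span (Set.range fun k : Fin 1 => yy (jJ k).1))⁰ := by
    refine mk_mem_nonZeroDivisors_of_forall fun z hz => ?_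
    rw [Qw_eq] at hz ⊢
    exact forall_mem_of_isWeaklyRegular_two hwg z hz
  -- the chart images of `w`
  have cw : chartBase yy 1 w = chartBase yy 1 (yy 1) * chartGen yy 1 0 :=
    reesChartBase_apply_eq_mul_chartGen yy 1 0
  -- (α) `w″` is a non-zero-divisor
  have hα : chartGen yy 1 0 ∈ (chartRing yy 1)⁰ := by
    have h := reesChartBase_mem_nonZeroDivisors_of_mem_nonZeroDivisors (I := Ideal.span (Set.range yy)) (yy 1)
      (Ideal.mem_span_range_self (f := yy) (x := 1)) hw0
    have h' : chartBase yy 1 w ∈ (chartRing yy 1)⁰ := h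
    rw [cw] at h'
    exact mem_nonZeroDivisors_of_mul_mem h'
  -- (β) `u/1` is regular modulo `(w″)`
  have hβ : ∀ z, chartBase yy 1 u * z ∈ Ideal.span {chartGen yy 1 0} → z ∈ Ideal.span {chartGen yy 1 0} := by
    have hr : Ideal.Quotient.mk (Ideal.span (Set.range fun k : Fin 1 => yy (jJ k).1)) u ∈
        (B ⧸ Ideal.span (Set.range fun k : Fin 1 => yy (jJ k).1))⁰ := by
      refine mk_mem_nonZeroDivisors_of_forall fun z hz => ?_
      rw [Qw_eq] at hz ⊢
      exact forall_mem_of_isWeaklyRegular₂ hwub z hz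
    have h := ChartStrictTransform.mk_chartBase_mem_nonZeroDivisors yy emb 0 jJ hx hjJ cov_w hr
    rw [Ew_eq] at h
    exact forall_mem_of_mk_mem_nonZeroDivisors h
  -- (γ) `b/1` is regular modulo `(w″, u/1)`
  have hγ : ∀ z, chartBase yy 1 b * z ∈ Ideal.span {chartGen yy 1 0} ⊔ Ideal.span {chartBase yy 1 u} →
      z ∈ Ideal.span {chartGen yy 1 0} ⊔ Ideal.span {chartBase yy 1 u} := by
    have hr : Ideal.Quotient.mk (Ideal.span (Set.range fun k : Fin 1 => yy (jJ k).1) ⊔ Ideal.span {u}) b ∈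
        (B ⧸ (Ideal.span (Set.range fun k : Fin 1 => yy (jJ k).1) ⊔ Ideal.span {u}))⁰ := by
      refine mk_mem_nonZeroDivisors_of_forall fun z hz => ?_
      rw [Qw_eq] at hz ⊢
      exact forall_mem_of_isWeaklyRegular₃ hwub z hz
    have h := mk_chartBase_mem_nonZeroDivisors_sup_single yy emb jJ hx hjJ cov_w hnz
      (Ideal.span {u}) hr
    rw [Ew_eq, map_span_singleton] at h
    exact forall_mem_of_mk_mem_nonZeroDivisors h
  have hw3 : RingTheory.Sequence.IsWeaklyRegular (chartRing yy 1)
      [chartGen yy 1 0, chartBase yy 1 u, chartBase yy 1 b] := isWeaklyRegular_three hα hβ hγ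
  refine ⟨?_, ?_⟩
  · have hq := isQuasiRegular_vec3 hw3
    have h1 := ChartPrincipal.isQuasiRegular_comp_equiv (Equiv.swap (0 : Fin 3) 1) hq
    have h2 := ChartPrincipal.isQuasiRegular_comp_equiv (Equiv.swap (1 : Fin 3) 2) h1
    rwa [vec3_rotate] at h2
  · have hreg' : IsRegularRing (B ⧸ (Ideal.span (Set.range fun k : Fin 1 => yy (jJ k).1) ⊔
        (Ideal.span {u} ⊔ Ideal.span {b}))) := by
      rw [Qw_eq, ← sup_assoc]
      exact hPreg
    have h := isRegularRing_quot_sup_map_single yy emb jJ hx hjJ cov_w hnz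
      (Ideal.span {u} ⊔ Ideal.span {b}) hreg'
    rw [Ew_eq, Ideal.map_sup, map_span_singleton, map_span_singleton, sup_comm] at h
    exact h

end Persistence

/-! ## The surface step over `Bl_N`, `N = (w, g)`, and the conic tower behind it -/

section Tower

variable {B : Type u} [CommRing B] [IsRegularRing B] (w g u b : B)

/-- The centre `N = (w, g)` as a family. -/
local notation3 "yy" => (![w, g] : Fin 2 → B)
/-- The residual of the member: `K₁ = (w) + (g b²) + (g u²)`. -/
local notation3 "K₁" => (Ideal.span {w} ⊔ Ideal.span {g * b ^ 2} ⊔ Ideal.span {g * u ^ 2})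
/-- The residual of the avatar of `L₁″`: `A₂ = (w) + (g b) + (g u)`. -/
local notation3 "A₂" => (Ideal.span {w} ⊔ Ideal.span {g * b} ⊔ Ideal.span {g * u})
/-- The residual of the avatar of `S₂`: `B₂ = (w², w g) + g² (b², u b, u²)`. -/
local notation3 "B₂" => (Ideal.span {w ^ 2} ⊔ Ideal.span {w * g} ⊔ Ideal.span {g ^ 2 * b ^ 2} ⊔
  Ideal.span {g ^ 2 * (u * b)} ⊔ Ideal.span {g ^ 2 * u ^ 2})

set_option maxHeartbeats 400000 in
-- `pow_mem` vs the statement-level `h ^ 4`: instance-path defeq through `HomogeneousLocalization` (as in p508825)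
/-- **THE SURFACE STEP (ring level).** For every regular ring `B` and `w, g, u, b ∈ B` with
`(w, g)` and `(w, u, b)` weakly regular and `B/(w, g)`, `B/(w, u, b)` regular rings, every
blowing up of `Spec B` along `(K₁ · A₂ · B₂) · N`, `N = (w, g)`, is a regular scheme: `Bl_N`
(regular centre, the surface `S₁`), then on its `g`-chart the conic tower of
`TwoQuadric.conicTower_isRegular` for the regular centre `(u, b, w″)` (the line `L₁″`, then the
surface `S₂`), on its `w`-chart nothing (the residual is Cartier).
[cite: Liu2002, Thm. 8.1.19 (a)] [cite: StacksProject, Tag 080A] [cite: StacksProject, Tag 0BIQ] -/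
theorem surfaceStep_isRegular (hwg : RingTheory.Sequence.IsWeaklyRegular B [w, g])
    (hNreg : IsRegularRing (B ⧸ (Ideal.span {w} ⊔ Ideal.span {g})))
    (hwub : RingTheory.Sequence.IsWeaklyRegular B [w, u, b])
    (hPreg : IsRegularRing (B ⧸ (Ideal.span {w} ⊔ Ideal.span {u} ⊔ Ideal.span {b})))
    {Y : Scheme.{u}} {f : Y ⟶ Spec (.of B)}
    (hf : IsBlowup f (affineBlowup.idealSheaf ((K₁ * A₂ * B₂) * (Ideal.span {w} ⊔ Ideal.span {g})))) :
    Scheme.IsRegular Y := by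
  rw [← span_range_vec2 w g] at hf
  have hx : IsQuasiRegular yy := isQuasiRegular_two hwg
  haveI hBx : IsRegularRing (B ⧸ Ideal.span (Set.range yy)) := by
    rw [span_range_vec2 w g]; exact hNreg
  refine isRegular_of_isBlowup_mul_of_charts yy (K₁ * A₂ * B₂) (fun j Y' ρ hρ => ?_) hf
  haveI hR : IsRegularRing (chartRing yy j) := isRegularRing_blowupChart yy j hx
  have hj : j = 0 ∨ j = 1 := by
    fin_cases j
    · exact Or.inl rfl
    · exact Or.inr rfl
  rcases hj with rfl | rfl
  · -- `w`-chart: `w = h`, `g = h g′`: everything is Cartier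
    have hh : chartBase yy 0 w ∈ (chartRing yy 0)⁰ :=
      reesChartBase_mem_nonZeroDivisors (yy 0) (Ideal.mem_span_range_self (f := yy) (x := 0))
    have cg : chartBase yy 0 g = chartBase yy 0 w * chartGen yy 0 1 :=
      reesChartBase_apply_eq_mul_chartGen yy 0 1
    rw [Ideal.map_mul, Ideal.map_mul, map_K₁, map_A₂, map_B₂, cg, wChart_three (A := chartRing yy 0),
      wChart_three (A := chartRing yy 0), wChart_B₂ (A := chartRing yy 0),
      Ideal.span_singleton_mul_span_singleton, Ideal.span_singleton_mul_span_singleton] at hρ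
    exact isRegular_of_isBlowup_span_singleton_nzd (mul_mem (mul_mem hh hh) (pow_mem hh 2)) hρ
  · -- `g`-chart: `g = h`, `w = h w″`: the conic tower for `(u, b, w″)`
    have hh : chartBase yy 1 g ∈ (chartRing yy 1)⁰ :=
      reesChartBase_mem_nonZeroDivisors (yy 1) (Ideal.mem_span_range_self (f := yy) (x := 1))
    have cw : chartBase yy 1 w = chartBase yy 1 g * chartGen yy 1 0 :=
      reesChartBase_apply_eq_mul_chartGen yy 1 0
    rw [Ideal.map_mul, Ideal.map_mul, map_K₁, map_A₂, map_B₂, cw, gChart_K₁ (A := chartRing yy 1),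
      gChart_A₂ (A := chartRing yy 1), gChart_B₂ (A := chartRing yy 1),
      collect_gChart (A := chartRing yy 1)] at hρ
    obtain ⟨hq3, hreg3⟩ := conicHyp_gChart w g u b hwg hwub hPreg
    refine CoreRungTower.isRegular_of_isBlowup_span_singleton_mul (pow_mem hh 4) _ (fun Y'' ρ' hρ' => ?_) hρ
    exact conicTower_isRegular _ _ _ hq3 hreg3 hρ'

end Tower

end CrossingLines

end Summit.ResolutionOfSingularities.ResolutionOfSingularities.Theorems

end
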